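import Summits.BirchSwinnertonDyer.BirchSwinnertonDyer.Theorems.PrintCf2SplitBadEisensteinTwoDivisibilitiesHalfDescentCore
import HarnessLib

/-!
# Crux `PrintCf2.SplitBadTwoRankOneOfFacts` (item 20368) and its halves 27850 / 27851 — the two halves of `BSD₂` on the class from the
# GROSS–ZAGIER-FREE finite-level INDEX currency: «`ord₂ #Ш(E/K)[2^∞] + ord₂ c_K ≤ 2·ord₂ [E(K):ℤP_K] − 2·ord₂ c`» resp. «`≥`» on Heegner frames

Cell `bsd-print-cf2`, seat `bsd-line-cf2-p1` g8 (LEAD on crux stmt-BirchSwinnertonDyer-20368; children stmt-BirchSwinnertonDyer-27850 UPPER /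
stmt-BirchSwinnertonDyer-27851 LOWER, glue 27852 closed). `--supports stmt-BirchSwinnertonDyer-20368` (helper). THEOREMS ONLY (0 definitions,
0 named facts, 0 `sorry`); CONDITIONAL on every displayed hypothesis. BSD is proved for no curve by any of this; no summit statement is proved
by this seat.

WHY. The skeletons of record on the children (planner g15, line `kside_finite_two`) carry the research stubs in the `K`-side `#Ш_an`
currency: «`∃ q' : ℚ, shaAnOver W' = q' ∧ ord₂ #Ш(W') ≤ ord₂ q'`» (resp. `≥`). The conjunct `shaAnOver W' = q'` is the RATIONALITY of
`#Ш_an(E/K) = L'(E/K,1)·#E(K)_tors² / (Ω · ∏ c_w · Reg)` — Gross–Zagier + Kolyvagin content, available in the tree only as the NAMED FACTS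
`gross_zagier` / `kolyvagin` (via `P2.shaAnOver_baseChange_eq_heegnerIndex_sq`); a stub without a fact antecedent cannot prove it, whatever
the research delivers. This file moves Gross–Zagier OUT of the research statement: the stubs become the purely arithmetic INDEX inequalities
on Heegner frames `(N, K, Dt, H, ι, P)` (planner g15's `KolyvaginBoundAtTwoOnFrames`, HOME `Lines/kolyvagin-finite-sketch.lean`, with the
Mordell–Weil rank `1` and the finiteness of `Ш(E/K)` also displayed as hypotheses), and the prints (GZ, Kolyvagin, modularity,
Friedberg–Hoffstein, parity, Heegner points — all inside `ToricPublishedInputs`) are consumed HERE, once, by name.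
* §1 (frame level) `upperOver_baseChange_of_heegnerIndexBound` / `lowerOver_baseChange_of_heegnerIndexBound`: GZ + Kolyvagin + modularity
  named facts + a frame with `d_K < −4` + the index inequality ⟹ the `K`-side half in the `#Ш_an` currency (`#Ш_an(E_K) = 4I²/(c²w²c_K)`,
  `w_K = 2`) — the arithmetic of lead g7's `upperOver_of_upperDivisibility_two` with the Λ-adic input replaced by its `T = 0` content.
* §2 (one `W` with `r_an(W) = 1`, no CM, no conductor hypothesis) `missingUpperBoundAt_two_of_heegnerIndexBound_of_twist` /
  `missingLowerBoundAt_two_of_heegnerIndexBound_of_twist`: `ToricPublishedInputs` + Milne + the index inequality on every frame of `W` + the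
  twin's `BSD₂` ⟹ `MissingUpperBoundAt W 2` / `MissingLowerBoundAt W 2` (route: parity ⟹ Friedberg–Hoffstein field mod `6` ⟹ `3` split ⟹
  `d_K < −4`; Heegner point; `L'(E/K,1) ≠ 0` ⟹ non-torsion; Kolyvagin; §1; lead g7's one-sided Milne descent p631598). = planner g15's B1′ and
  its Eisenstein twin.
* Class level, BY NAME (child cruxes 27850 / 27851 and the parent from {`ToricPublishedInputs`, Milne any-model} + the index stubs): the
  companion file `PrintCf2SplitBadTwoHalvesOfHeegnerIndexAtTwoByName` (kept apart so that THIS file is route-independent: no `Theses.PrintCf2`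
  in its import cone).

References: [GrossZagier1986] Thm. I.6.3, V.(2.2); [Kolyvagin1990] Thm. A; [Gross1991] (1.1), Thm. 1.3; [Milne1972ArithmeticAV] §1 Thm. 1;
[FriedbergHoffstein1995] Thm. B; [Miller2011LMS] Def. 1.1; [JetchevSkinnerWan2017] §7.4.1 (shape of the lower half).
-/

set_option autoImplicit false

-- D-0017 layout: summit = sub-problem, so `Summit.BirchSwinnertonDyer.BirchSwinnertonDyer.…` is the mandated namespace of Theorems files.
set_option linter.dupNamespace false

noncomputable section

open scoped Classical MatrixGroups ModularForm Topology NumberField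

namespace Summit.BirchSwinnertonDyer.BirchSwinnertonDyer.Theorems.PrintCf2.EisensteinTwo

open Filter CongruenceSubgroup WeierstrassCurve NumberField IsDedekindDomain Field PowerSeries
  Literature.NumberTheory.EllipticCurves Literature.NumberTheory.EllipticCurves.ModularForms
  Literature.NumberTheory.EllipticCurves.LiuZhangZhang2018 Literature.NumberTheory.EllipticCurves.Rank1Residual
  Literature.NumberTheory.EllipticCurves.Rank1Residual.Typed Literature.NumberTheory.EllipticCurves.KrizLi2019
  Literature.NumberTheory.GaloisRepresentations Literature.NumberTheory.GaloisCohomology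
  Summit.BirchSwinnertonDyer.Rank1Residual Summit.BirchSwinnertonDyer.Rank1Residual.X11b
  Summit.BirchSwinnertonDyer.Rank1Residual.X11b.AcSelmer Summit.BirchSwinnertonDyer.Rank1Residual.X11b.CongruenceLimit
  Summit.BirchSwinnertonDyer.Rank1Residual.X11b.Halves Summit.BirchSwinnertonDyer.Rank1Residual.X2
  Summit.BirchSwinnertonDyer.Rank1Residual.Additive Summit.BirchSwinnertonDyer.Rank1Residual.AdditivePotMult
  Summit.BirchSwinnertonDyer.BirchSwinnertonDyer.Theses.UniversalToricDescent
  Summit.BirchSwinnertonDyer.BirchSwinnertonDyer.Theorems.UniversalToricDescentWaldspurgerFlat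

/-! ### §1 Frame level: the index inequality ⟹ the `K`-side half in the `#Ш_an` currency (Gross–Zagier arithmetic, `w_K = 2`) -/

section Frame

variable (W : WeierstrassCurve ℚ) [W.IsElliptic] (K : Type) [Field K] [NumberField K] {N : ℕ} [NeZero N]
  (Dt : ModularParametrizationData W N) (H : HeegnerDatum N (NumberField.discr K)) (ιK : K →+* ℂ) (P : (W.baseChange K).toAffine.Point)

/-- The `2`-adic valuation of the Gross–Zagier value `#Ш_an(E_K) = 4 I²/(c² w² c_K)` at a field with `w_K = 2`:
`ord₂ = 2·ord₂ I − 2·ord₂ c − ord₂ c_K` (`I ≠ 0`, `c ≠ 0`, `c_K ≠ 0`). Bookkeeping. [folklore] -/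
theorem padicValRat_two_heegnerIndex_sq_value {I : ℕ} {c : ℤ} {cK : ℕ} (hI : I ≠ 0) (hc : c ≠ 0) (hcK : cK ≠ 0) :
    padicValRat 2 (4 * (I : ℚ) ^ 2 / ((c : ℚ) ^ 2 * ((2 : ℕ) : ℚ) ^ 2 * (cK : ℚ))) =
      2 * (padicValNat 2 I : ℤ) - 2 * (padicValNat 2 c.natAbs : ℤ) - (padicValNat 2 cK : ℤ) := by
  have hIQ : (I : ℚ) ≠ 0 := by exact_mod_cast hI
  have hcQ : (c : ℚ) ≠ 0 := by exact_mod_cast hc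
  have hwQ : ((2 : ℕ) : ℚ) ≠ 0 := by norm_num
  have hcKQ : (cK : ℚ) ≠ 0 := by exact_mod_cast hcK
  have hcval : padicValRat 2 (c : ℚ) = (padicValNat 2 c.natAbs : ℤ) := by
    rw [padicValRat.of_int]; rfl
  have h2val : padicValRat 2 (((2 : ℕ) : ℚ)) = 1 := by
    rw [padicValRat.of_nat, padicValNat_self]; rfl
  have h4val : padicValRat 2 (4 : ℚ) = 2 := by
    rw [show (4 : ℚ) = ((2 : ℕ) : ℚ) ^ 2 by norm_num, padicValRat.pow, h2val]; norm_num
  rw [padicValRat.div (mul_ne_zero (by norm_num) (pow_ne_zero 2 hIQ))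
      (mul_ne_zero (mul_ne_zero (pow_ne_zero 2 hcQ) (pow_ne_zero 2 hwQ)) hcKQ),
    padicValRat.mul (by norm_num) (pow_ne_zero 2 hIQ), padicValRat.mul (mul_ne_zero (pow_ne_zero 2 hcQ) (pow_ne_zero 2 hwQ)) hcKQ,
    padicValRat.mul (pow_ne_zero 2 hcQ) (pow_ne_zero 2 hwQ), padicValRat.pow, padicValRat.pow, padicValRat.pow, h4val, hcval, h2val,
    padicValRat.of_nat, padicValRat.of_nat]
  push_cast
  ring

/-- **UPPER index bound on a frame ⟹ the `K`-side Euler-system half `ord₂ #Ш(E_K) ≤ ord₂ #Ш_an(E_K)`** (`#Ш_an(E_K) = 4I²/(c²w²c_K)`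
rational by Gross–Zagier + Kolyvagin, `P2.shaAnOver_baseChange_eq_heegnerIndex_sq`). Frame `(N, K, Dt, H, ι, P)` of `W` with `d_K < −4`
(so `w_K = 2`), `P` the Heegner point, non-torsion, `r_an(E_K) = 1`; the INDEX inequality
`ord₂ #Ш(E/K)[2^∞] + ord₂ c_K ≤ 2·ord₂ [E(K):ℤP] − 2·ord₂ c` is the hypothesis `hIdx`. CONDITIONAL on the named facts `hGZ`, `hKo`, `hmod`.
[cite: GrossZagier1986, Thm. I.6.3 and V.(2.2)] [cite: Kolyvagin1990, Thm. A (shape)] -/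
theorem upperOver_baseChange_of_heegnerIndexBound
    (hGZ : gross_zagier N W K) (hKo : kolyvagin N W K) (hmod : hasEntireLFunction_rat)
    (hK : IsImaginaryQuadratic K) (hd4 : NumberField.discr K < -4) (hHN : SatisfiesHeegnerHypothesis N K)
    (hP : WeierstrassCurve.Affine.Point.map ιK.toRatAlgHom P = heegnerPointComplex Dt H)
    (hPinf : ¬ IsOfFinAddOrder P) (hrK : (W.baseChange K).analyticRank = 1)
    (hIdx : (padicValNat 2 (Nat.card (AddCommGroup.primaryComponent (W.baseChange K).sha 2)) : ℤ) +
        (padicValNat 2 (W.baseChange K).tamagawaProduct : ℤ) ≤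
      2 * (padicValNat 2 (AddSubgroup.zmultiples P).index : ℤ) - 2 * (padicValNat 2 Dt.c.natAbs : ℤ)) :
    ∃ q' : ℚ, shaAnOver (W.baseChange K) = (q' : ℂ) ∧
      (padicValNat 2 (W.baseChange K).shaOrder : ℤ) ≤ padicValRat 2 q' := by
  have hc0 : Dt.c ≠ 0 := Dt.maninConstant_ne_zero_holds
  obtain ⟨hrk, hShaK, hval⟩ := Summit.BirchSwinnertonDyer.Rank1Residual.P2.shaAnOver_baseChange_eq_heegnerIndex_sq W N K Dt H ιK P
    hGZ hKo hmod hK hHN hP hc0 hrK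
  haveI : Finite (W.baseChange K).sha := hShaK
  refine ⟨_, hval, ?_⟩
  set I : ℕ := (AddSubgroup.zmultiples P).index with hI_def
  have hw2 : Units.torsionOrder K = 2 :=
    Literature.NumberTheory.QuadraticFields.Quadratic.torsionOrder_eq_two_of_discr_lt_neg_four hK.1 hd4
  have hheight := Summit.BirchSwinnertonDyer.Rank1Residual.P2.torsionOrder_sq_mul_canonicalHeight_eq_index_sq_mul_regulator
    (W.baseChange K) hrk P hPinf
  have htK : 0 < (W.baseChange K).torsionOrder := (W.baseChange K).torsionOrder_pos_holds
  have hI0 : I ≠ 0 := by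
    intro hI
    rw [← hI_def, hI] at hheight
    have h0 : ((W.baseChange K).torsionOrder : ℝ) ^ 2 * P.canonicalHeight = 0 := by rw [hheight]; simp
    rcases mul_eq_zero.mp h0 with h' | h'
    · exact absurd ((pow_eq_zero_iff two_ne_zero).mp h') (by exact_mod_cast htK.ne')
    · exact hPinf ((Affine.Point.canonicalHeight_eq_zero_iff_holds P).mp h')
  have hcK : (W.baseChange K).tamagawaProduct ≠ 0 := (W.baseChange K).tamagawaProduct_pos_holds.ne'
  have hsha : padicValNat 2 (Nat.card (AddCommGroup.primaryComponent (W.baseChange K).sha 2)) =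
      padicValNat 2 (W.baseChange K).shaOrder :=
    Literature.NumberTheory.EllipticCurves.padicValNat_card_addPrimaryComponent 2
  rw [hw2, padicValRat_two_heegnerIndex_sq_value hI0 hc0 hcK, ← hsha]
  linarith

/-- **LOWER index bound on a frame ⟹ the `K`-side Eisenstein half `ord₂ #Ш_an(E_K) ≤ ord₂ #Ш(E_K)`.** Same frame data; the hypothesis
`hIdx` is the LOWER index inequality `2·ord₂ [E(K):ℤP] − 2·ord₂ c ≤ ord₂ #Ш(E/K)[2^∞] + ord₂ c_K` (the main-conjecture / Eisenstein
direction at `2`: the Heegner point is no more `2`-divisible in `E(K)` than `Ш(E/K)[2^∞]` and the Tamagawa numbers account for).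
CONDITIONAL on `hGZ`, `hKo`, `hmod`. [cite: GrossZagier1986, Thm. I.6.3 and V.(2.2)] [cite: JetchevSkinnerWan2017, §7.4.1 (shape)] -/
theorem lowerOver_baseChange_of_heegnerIndexBound
    (hGZ : gross_zagier N W K) (hKo : kolyvagin N W K) (hmod : hasEntireLFunction_rat)
    (hK : IsImaginaryQuadratic K) (hd4 : NumberField.discr K < -4) (hHN : SatisfiesHeegnerHypothesis N K)
    (hP : WeierstrassCurve.Affine.Point.map ιK.toRatAlgHom P = heegnerPointComplex Dt H)
    (hPinf : ¬ IsOfFinAddOrder P) (hrK : (W.baseChange K).analyticRank = 1)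
    (hIdx : 2 * (padicValNat 2 (AddSubgroup.zmultiples P).index : ℤ) - 2 * (padicValNat 2 Dt.c.natAbs : ℤ) ≤
      (padicValNat 2 (Nat.card (AddCommGroup.primaryComponent (W.baseChange K).sha 2)) : ℤ) +
        (padicValNat 2 (W.baseChange K).tamagawaProduct : ℤ)) :
    ∃ q' : ℚ, shaAnOver (W.baseChange K) = (q' : ℂ) ∧
      padicValRat 2 q' ≤ (padicValNat 2 (W.baseChange K).shaOrder : ℤ) := by
  have hc0 : Dt.c ≠ 0 := Dt.maninConstant_ne_zero_holds
  obtain ⟨hrk, hShaK, hval⟩ := Summit.BirchSwinnertonDyer.Rank1Residual.P2.shaAnOver_baseChange_eq_heegnerIndex_sq W N K Dt H ιK P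
    hGZ hKo hmod hK hHN hP hc0 hrK
  haveI : Finite (W.baseChange K).sha := hShaK
  refine ⟨_, hval, ?_⟩
  set I : ℕ := (AddSubgroup.zmultiples P).index with hI_def
  have hw2 : Units.torsionOrder K = 2 :=
    Literature.NumberTheory.QuadraticFields.Quadratic.torsionOrder_eq_two_of_discr_lt_neg_four hK.1 hd4
  have hheight := Summit.BirchSwinnertonDyer.Rank1Residual.P2.torsionOrder_sq_mul_canonicalHeight_eq_index_sq_mul_regulator
    (W.baseChange K) hrk P hPinf
  have htK : 0 < (W.baseChange K).torsionOrder := (W.baseChange K).torsionOrder_pos_holds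
  have hI0 : I ≠ 0 := by
    intro hI
    rw [← hI_def, hI] at hheight
    have h0 : ((W.baseChange K).torsionOrder : ℝ) ^ 2 * P.canonicalHeight = 0 := by rw [hheight]; simp
    rcases mul_eq_zero.mp h0 with h' | h'
    · exact absurd ((pow_eq_zero_iff two_ne_zero).mp h') (by exact_mod_cast htK.ne')
    · exact hPinf ((Affine.Point.canonicalHeight_eq_zero_iff_holds P).mp h')
  have hcK : (W.baseChange K).tamagawaProduct ≠ 0 := (W.baseChange K).tamagawaProduct_pos_holds.ne'
  have hsha : padicValNat 2 (Nat.card (AddCommGroup.primaryComponent (W.baseChange K).sha 2)) =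
      padicValNat 2 (W.baseChange K).shaOrder :=
    Literature.NumberTheory.EllipticCurves.padicValNat_card_addPrimaryComponent 2
  rw [hw2, padicValRat_two_heegnerIndex_sq_value hI0 hc0 hcK, ← hsha]
  linarith

end Frame

/-! ### §2 One `W` with `r_an(W) = 1`: the index inequality on every Heegner frame ⟹ the half of `BSD₂(W)` (B1′ and its twin) -/

/-- **B1′ — THE EULER-SYSTEM HALF OF `BSD₂(W)` FROM THE UPPER INDEX BOUND ON HEEGNER FRAMES.** For ONE globally minimal `W/ℚ` with
`r_an(W) = 1` (no CM, no conductor hypothesis), GIVEN the toric prints `hF` (Gross–Zagier, Kolyvagin, GZK, modularity, Friedberg–Hoffstein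
Thm. B, parity, Heegner points are used), Milne 1972 on minimal models `hMilne`, the UPPER INDEX BOUND `hIdx` on every Heegner frame
`(N, K, Dt, H, ι, P)` of `W` with `d_K < −4`, `P` non-torsion, `rank E(K) = 1`, `Ш(E/K)` finite —
`ord₂ #Ш(E/K)[2^∞] + ord₂ c_K ≤ 2·ord₂ [E(K):ℤP] − 2·ord₂ c` (planner g15's `KolyvaginBoundAtTwoOnFrames W`, rank and finiteness displayed) —
and the twin's `BSD₂` `hTw`, THEN `MissingUpperBoundAt W 2` (`ord₂ #Ш(W) ≤ ord₂ #Ш_an(W)`). Route: parity ⟹ Friedberg–Hoffstein field `K` with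
`6` split ⟹ `d_K < −4`; Heegner point (`hHP`); `L'(E/K,1) = L'(E,1)·L(E^{d_K},1) ≠ 0` ⟹ non-torsion (Gross–Zagier); Kolyvagin; §1; lead g7's
one-sided Milne descent `missingUpperBoundAt_of_upperOver_of_bsdp_twist` (p631598).
[cite: Kolyvagin1990, Thm. A (shape)] [cite: GrossZagier1986, V.(2.2)] [cite: Milne1972ArithmeticAV, §1 Thm. 1] [cite: FriedbergHoffstein1995, Thm. B]
[cite: Miller2011LMS, Def. 1.1] -/
theorem missingUpperBoundAt_two_of_heegnerIndexBound_of_twist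
    (hF : ToricPublishedInputs) (hMilne : Milne1972.bsdQuotient_baseChange_quadratic)
    (W : WeierstrassCurve ℚ) [W.IsElliptic] [W.IsGloballyMinimal] (hr : W.analyticRank = 1)
    (hIdx : ∀ (N : ℕ) [NeZero N] (K : Type) [Field K] [NumberField K] (Dt : ModularParametrizationData W N)
      (H : HeegnerDatum N (NumberField.discr K)) (ι : K →+* ℂ) (P : (W.baseChange K).toAffine.Point),
      W.conductorNorm ℤ = N → IsImaginaryQuadratic K → SatisfiesHeegnerHypothesis N K → NumberField.discr K < -4 →
      WeierstrassCurve.Affine.Point.map ι.toRatAlgHom P = heegnerPointComplex Dt H → ¬ IsOfFinAddOrder P →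
      (W.baseChange K).mordellWeilRank = 1 → Finite (W.baseChange K).sha →
      (padicValNat 2 (Nat.card (AddCommGroup.primaryComponent (W.baseChange K).sha 2)) : ℤ) +
          (padicValNat 2 (W.baseChange K).tamagawaProduct : ℤ) ≤
        2 * (padicValNat 2 (AddSubgroup.zmultiples P).index : ℤ) - 2 * (padicValNat 2 Dt.c.natAbs : ℤ))
    (hTw : ∀ (N : ℕ) [NeZero N] (K : Type) [Field K] [NumberField K]
      (Wd : WeierstrassCurve ℚ) [Wd.IsElliptic] [Wd.IsGloballyMinimal],
      W.conductorNorm ℤ = N → IsImaginaryQuadratic K → SatisfiesHeegnerHypothesis N K →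
      (∃ C : VariableChange ℚ, C • W.quadraticTwist (NumberField.discr K : ℚ) = Wd) →
      (W.quadraticTwist (NumberField.discr K : ℚ)).entireLFunction 1 ≠ 0 → BSDp Wd 2) :
    MissingUpperBoundAt W 2 := by
  obtain ⟨hGZ, hKo, hGZK, hmod, -, -, -, hFH, hpar, hHP⟩ := hF
  haveI hN0 : NeZero (W.conductorNorm ℤ) := ⟨W.conductorNorm_pos_holds.ne'⟩
  ------------------------------------------------------------------ parity and the Friedberg–Hoffstein field (modulus `6`, so `3` splits)
  have hw : W.rootNumber = -1 := by
    rcases W.rootNumber_eq_one_or with h | h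
    · exfalso
      have heven : Even W.analyticRank := (hpar W).mpr h
      rw [hr] at heven
      exact Nat.not_even_one heven
    · exact h
  obtain ⟨K, _, _, hK, -, hHN, hH6, hLt⟩ := hFH W hw 6 (by norm_num) 0
  have hd4 : NumberField.discr K < -4 :=
    discr_lt_neg_four_of_three_split hK (hH6 3 Nat.prime_three (by norm_num : (3 : ℕ) ∣ 6))
  ------------------------------------------------------------------ the Heegner point, non-torsion, Kolyvagin
  obtain ⟨P, Dt, H, ι, hP⟩ := hHP W K hK hHN
  have hL0 : W.entireLFunction 1 = 0 := entireLFunction_one_eq_zero_of_analyticRank_eq_one hr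
  obtain ⟨-, hderiv⟩ := leadingLCoeff_eq_deriv_of_analyticRank_eq_one hr
  have hLK : LDerivEK W K ≠ 0 := by
    rw [lDerivEK_eq_deriv_mul W K hmod hL0]; exact mul_ne_zero hderiv hLt
  have hnt : ¬ IsOfFinAddOrder P :=
    (lDerivEK_ne_zero_iff_not_isOfFinAddOrder W (W.conductorNorm ℤ) K (hGZ _ W K) hK hHN ⟨Dt, H, ι, hP⟩).mp hLK
  have hKoK : Literature.NumberTheory.EllipticCurves.kolyvagin (W.conductorNorm ℤ) W K := hKo _ W K
  obtain ⟨hrk, hfinK⟩ := hKoK hK hHN ⟨Dt, H, ι, hP⟩ hnt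
  haveI : Finite (W.baseChange K).sha := hfinK
  ------------------------------------------------------------------ ranks of the pair and the twin
  have h2 : Module.finrank ℚ K = 2 := hK.1
  haveI : (W.baseChange K).IsGloballyMinimal := W.isGloballyMinimal_baseChange_of_satisfiesHeegnerHypothesis K h2 hHN
  have hD0 : (NumberField.discr K : ℚ) ≠ 0 := by exact_mod_cast NumberField.discr_ne_zero K
  haveI hEt : (W.quadraticTwist (NumberField.discr K : ℚ)).IsElliptic := W.isElliptic_quadraticTwist hD0
  have hrd0 : (W.quadraticTwist (NumberField.discr K : ℚ)).analyticRank = 0 :=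
    ((W.quadraticTwist (NumberField.discr K : ℚ)).analyticRank_eq_zero_iff_holds (hmod _)).mpr hLt
  have hrK : (W.baseChange K).analyticRank = 1 :=
    (Summit.BirchSwinnertonDyer.Rank1Residual.P2.analyticRank_baseChange_eq_one_iff W K hmod h2).mpr (Or.inl ⟨hr, hrd0⟩)
  obtain ⟨Cd, hCd⟩ := hasGlobalMinimalModel_rat_holds (W.quadraticTwist (NumberField.discr K : ℚ))
  haveI : (Cd • W.quadraticTwist (NumberField.discr K : ℚ)).IsGloballyMinimal := hCd
  have hWd : BSDp (Cd • W.quadraticTwist (NumberField.discr K : ℚ)) 2 :=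
    hTw (W.conductorNorm ℤ) K (Cd • W.quadraticTwist (NumberField.discr K : ℚ)) rfl hK hHN ⟨Cd, rfl⟩ hLt
  have hrW : W.analyticRank ≤ 1 := by rw [hr]
  have hrd : (Cd • W.quadraticTwist (NumberField.discr K : ℚ)).analyticRank ≤ 1 := by
    rw [analyticRank_smul, hrd0]; exact zero_le_one
  ------------------------------------------------------------------ the index bound on THIS frame, §1, and the one-sided descent
  have hIdx₁ := hIdx (W.conductorNorm ℤ) K Dt H ι P rfl hK hHN hd4 hP hnt hrk hfinK
  have hKup := upperOver_baseChange_of_heegnerIndexBound W K Dt H ι P (hGZ _ W K) hKoK hmod hK hd4 hHN hP hnt hrK hIdx₁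
  exact missingUpperBoundAt_of_upperOver_of_bsdp_twist W 2 K (Cd • W.quadraticTwist (NumberField.discr K : ℚ)) (W.baseChange K)
    hGZK hmod hMilne hrW h2 ⟨Cd, rfl⟩ hrd ⟨1, one_smul _ _⟩ hKup hWd

/-- **B2′ — THE EISENSTEIN HALF OF `BSD₂(W)` FROM THE LOWER INDEX BOUND ON HEEGNER FRAMES.** Same data with `hIdx` the LOWER index bound
`2·ord₂ [E(K):ℤP] − 2·ord₂ c ≤ ord₂ #Ш(E/K)[2^∞] + ord₂ c_K` on every Heegner frame of `W` (`d_K < −4`, `P` non-torsion, rank `1`, `Ш(E/K)`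
finite): THEN `MissingLowerBoundAt W 2` (`ord₂ #Ш_an(W) ≤ ord₂ #Ш(W)`), via §1 and `missingLowerBoundAt_of_lowerOver_of_bsdp_twist`.
[cite: JetchevSkinnerWan2017, §7.4.1 (shape)] [cite: GrossZagier1986, V.(2.2)] [cite: Milne1972ArithmeticAV, §1 Thm. 1]
[cite: FriedbergHoffstein1995, Thm. B] [cite: Miller2011LMS, Def. 1.1] -/
theorem missingLowerBoundAt_two_of_heegnerIndexBound_of_twist
    (hF : ToricPublishedInputs) (hMilne : Milne1972.bsdQuotient_baseChange_quadratic)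
    (W : WeierstrassCurve ℚ) [W.IsElliptic] [W.IsGloballyMinimal] (hr : W.analyticRank = 1)
    (hIdx : ∀ (N : ℕ) [NeZero N] (K : Type) [Field K] [NumberField K] (Dt : ModularParametrizationData W N)
      (H : HeegnerDatum N (NumberField.discr K)) (ι : K →+* ℂ) (P : (W.baseChange K).toAffine.Point),
      W.conductorNorm ℤ = N → IsImaginaryQuadratic K → SatisfiesHeegnerHypothesis N K → NumberField.discr K < -4 →
      WeierstrassCurve.Affine.Point.map ι.toRatAlgHom P = heegnerPointComplex Dt H → ¬ IsOfFinAddOrder P →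
      (W.baseChange K).mordellWeilRank = 1 → Finite (W.baseChange K).sha →
      2 * (padicValNat 2 (AddSubgroup.zmultiples P).index : ℤ) - 2 * (padicValNat 2 Dt.c.natAbs : ℤ) ≤
        (padicValNat 2 (Nat.card (AddCommGroup.primaryComponent (W.baseChange K).sha 2)) : ℤ) +
          (padicValNat 2 (W.baseChange K).tamagawaProduct : ℤ))
    (hTw : ∀ (N : ℕ) [NeZero N] (K : Type) [Field K] [NumberField K]
      (Wd : WeierstrassCurve ℚ) [Wd.IsElliptic] [Wd.IsGloballyMinimal],
      W.conductorNorm ℤ = N → IsImaginaryQuadratic K → SatisfiesHeegnerHypothesis N K →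
      (∃ C : VariableChange ℚ, C • W.quadraticTwist (NumberField.discr K : ℚ) = Wd) →
      (W.quadraticTwist (NumberField.discr K : ℚ)).entireLFunction 1 ≠ 0 → BSDp Wd 2) :
    MissingLowerBoundAt W 2 := by
  obtain ⟨hGZ, hKo, hGZK, hmod, -, -, -, hFH, hpar, hHP⟩ := hF
  haveI hN0 : NeZero (W.conductorNorm ℤ) := ⟨W.conductorNorm_pos_holds.ne'⟩
  ------------------------------------------------------------------ parity and the Friedberg–Hoffstein field (modulus `6`, so `3` splits)
  have hw : W.rootNumber = -1 := by
    rcases W.rootNumber_eq_one_or with h | h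
    · exfalso
      have heven : Even W.analyticRank := (hpar W).mpr h
      rw [hr] at heven
      exact Nat.not_even_one heven
    · exact h
  obtain ⟨K, _, _, hK, -, hHN, hH6, hLt⟩ := hFH W hw 6 (by norm_num) 0
  have hd4 : NumberField.discr K < -4 :=
    discr_lt_neg_four_of_three_split hK (hH6 3 Nat.prime_three (by norm_num : (3 : ℕ) ∣ 6))
  ------------------------------------------------------------------ the Heegner point, non-torsion, Kolyvagin
  obtain ⟨P, Dt, H, ι, hP⟩ := hHP W K hK hHN
  have hL0 : W.entireLFunction 1 = 0 := entireLFunction_one_eq_zero_of_analyticRank_eq_one hr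
  obtain ⟨-, hderiv⟩ := leadingLCoeff_eq_deriv_of_analyticRank_eq_one hr
  have hLK : LDerivEK W K ≠ 0 := by
    rw [lDerivEK_eq_deriv_mul W K hmod hL0]; exact mul_ne_zero hderiv hLt
  have hnt : ¬ IsOfFinAddOrder P :=
    (lDerivEK_ne_zero_iff_not_isOfFinAddOrder W (W.conductorNorm ℤ) K (hGZ _ W K) hK hHN ⟨Dt, H, ι, hP⟩).mp hLK
  have hKoK : Literature.NumberTheory.EllipticCurves.kolyvagin (W.conductorNorm ℤ) W K := hKo _ W K
  obtain ⟨hrk, hfinK⟩ := hKoK hK hHN ⟨Dt, H, ι, hP⟩ hnt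
  haveI : Finite (W.baseChange K).sha := hfinK
  ------------------------------------------------------------------ ranks of the pair and the twin
  have h2 : Module.finrank ℚ K = 2 := hK.1
  haveI : (W.baseChange K).IsGloballyMinimal := W.isGloballyMinimal_baseChange_of_satisfiesHeegnerHypothesis K h2 hHN
  have hD0 : (NumberField.discr K : ℚ) ≠ 0 := by exact_mod_cast NumberField.discr_ne_zero K
  haveI hEt : (W.quadraticTwist (NumberField.discr K : ℚ)).IsElliptic := W.isElliptic_quadraticTwist hD0
  have hrd0 : (W.quadraticTwist (NumberField.discr K : ℚ)).analyticRank = 0 :=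
    ((W.quadraticTwist (NumberField.discr K : ℚ)).analyticRank_eq_zero_iff_holds (hmod _)).mpr hLt
  have hrK : (W.baseChange K).analyticRank = 1 :=
    (Summit.BirchSwinnertonDyer.Rank1Residual.P2.analyticRank_baseChange_eq_one_iff W K hmod h2).mpr (Or.inl ⟨hr, hrd0⟩)
  obtain ⟨Cd, hCd⟩ := hasGlobalMinimalModel_rat_holds (W.quadraticTwist (NumberField.discr K : ℚ))
  haveI : (Cd • W.quadraticTwist (NumberField.discr K : ℚ)).IsGloballyMinimal := hCd
  have hWd : BSDp (Cd • W.quadraticTwist (NumberField.discr K : ℚ)) 2 :=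
    hTw (W.conductorNorm ℤ) K (Cd • W.quadraticTwist (NumberField.discr K : ℚ)) rfl hK hHN ⟨Cd, rfl⟩ hLt
  have hrW : W.analyticRank ≤ 1 := by rw [hr]
  have hrd : (Cd • W.quadraticTwist (NumberField.discr K : ℚ)).analyticRank ≤ 1 := by
    rw [analyticRank_smul, hrd0]; exact zero_le_one
  ------------------------------------------------------------------ the index bound on THIS frame, §1, and the one-sided descent
  have hIdx₁ := hIdx (W.conductorNorm ℤ) K Dt H ι P rfl hK hHN hd4 hP hnt hrk hfinK
  have hKlo := lowerOver_baseChange_of_heegnerIndexBound W K Dt H ι P (hGZ _ W K) hKoK hmod hK hd4 hHN hP hnt hrK hIdx₁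
  exact missingLowerBoundAt_of_lowerOver_of_bsdp_twist W 2 K (Cd • W.quadraticTwist (NumberField.discr K : ℚ)) (W.baseChange K)
    hGZK hmod hMilne hrW h2 ⟨Cd, rfl⟩ hrd ⟨1, one_smul _ _⟩ hKlo hWd

end Summit.BirchSwinnertonDyer.BirchSwinnertonDyer.Theorems.PrintCf2.EisensteinTwo

end
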